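/-
Copyright (c) 2026. All rights reserved.
Released under Apache 2.0 license as described in the file LICENSE.
Authors: HodgeCM publication cell (pub-hodgecm), GR lane, seat GR-1 (`pub-hodgecm-own-real34`).
-/
import Literature.NumberTheory.GelbartRogawski1991.QuadExtSplittingCharArchTwistReal
import Literature.NumberTheory.GelbartRogawski1991.QuadExtSplittingCharArchComponents
import Literature.NumberTheory.Automorphic.UnitaryGroupArchSignPatterns
import HarnessLib

/-!
# `|det_Δ|^{1/2}` and `χ(det_Δ)` at the Levi sign representatives of the archimedean Siegel parabolic

Topic `NumberTheory/GelbartRogawski1991`; namespace `Literature.NumberTheory.GelbartRogawski1991.GRConstructionGen`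
(telescope of `DoubledUnitaryGlobalSplittingDataGen`).  KERNEL only: proved theorems; no definition, no named fact, no
`sorry`.  For the Cayley–Levi element `q = mA r` of a sign pattern `r = signPatternGL ρ` (real coordinates `ρ w ∈ GL_n(ℝ)`,
complex coordinates `1`; `mA` any homomorphism into `U(J^𝔻)(F ⊗ ℝ)` with `(mA r, 1) ∈ P_Δ(𝔸)` and `archMat (deltaBlock (mA r, 1)) = r`,
`DoubledUnitaryArchSiegelSignReps.exists_signReps`), Kudla's `x(q) = det_Δ (q,1)` is the archimedean idèle with real
coordinates `det ρ(w)` and complex coordinates `1`, whence: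

* **`modDelta_leviCayley_signPattern_eq_one`** — `modDelta (q,1) = |x(q)|_{𝔸_E}^{1/2} = 1` when `|det ρ(w)| = 1` for all `w`;
* `chiDet_leviCayley_signPattern_eq_prod` — `χ(x(q)) = ∏_{w real} χ̃_w(det ρ(w))` (`χ̃_w = archComponentR χ w`);
* **`chiDet_leviCayley_pair_eq_one`** — at the PAIR representative (`ρ = mulSingle w_k ε · mulSingle (c⁻¹w_k) ε`):
  `χ(x(q)) = χ̃_{w_k}(det ε) · χ̃_{c⁻¹w_k}(det ε) = 1` for `χ|_{𝕀_F} = ε_{E/F}^m`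
  (`archComponentR_mul_archComponentR_smul_inv`), so the prescribed origin value `χ(det_Δ)|det_Δ|^{1/2}` at the pair
  representative is `1` — the scalar input of `hval₀` in `DoubledWeilRepresentationArchLiftSigns.exists_isArchHalf_twist_prod_signs`.

([Kudla1994, §3]: `x(m(a)) = det a`; [HarrisKudlaSweet1996, §1 (1.15)]; [GelbartRogawski1991, §3.1 p. 456 (3.1.2)].)
Written for the stage-1 cell `pub-hodgecm` (seat GR-1); nothing here is a claim of the manuscripts adjudicated by that cell.

## References

* S. S. Kudla, Israel J. Math. 87 (1994) 361–401, §3 [Kudla1994].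
* M. Harris, S. S. Kudla, W. J. Sweet, J. Amer. Math. Soc. 9 (1996), §1 (1.15) [HarrisKudlaSweet1996].
* S. Gelbart, J. Rogawski, Invent. Math. 105 (1991), §3.1 p. 456 (3.1.2) [GelbartRogawski1991].
-/

set_option autoImplicit false

noncomputable section

open scoped Classical
open scoped Matrix MatrixGroups
open NumberField NumberField.InfinitePlace NumberField.mixedEmbedding IsDedekindDomain
open Literature.NumberTheory.Automorphic Literature.NumberTheory.Automorphic.UnitaryGroup
open Literature.NumberTheory.Weil1964
open Literature.NumberTheory.GaloisRepresentations
open Literature.RepresentationTheory.HeisenbergGroup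
open Literature.RepresentationTheory.HarrisKudlaSweet1996
open Literature.NumberTheory.QuadraticForms (ideleInfiniteComponent val_ideleInfiniteComponent)
open Literature.NumberTheory.GelbartRogawski1991.UnitaryDualPair.ArchSplitting.QuadExt

namespace Literature.NumberTheory.GelbartRogawski1991.GRConstructionGen

open UnitaryDualPair

variable (F : Type) [Field F] [NumberField F] (E : Type) [Field E] [NumberField E] [Algebra F E]
  [Algebra.IsQuadraticExtension F E]
variable (c : E ≃ₐ[F] E) {δ : E} (hcδ : c δ = -δ) (hδ : δ ≠ 0) {d : F} (hd : δ * δ = algebraMap F E d)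
variable {N M n : ℕ} (e : Fin N × Fin M ≃ Fin n)
  (TV : Matrix (Fin N) (Fin N) F) (hV : TV.IsSymm) (hVd : IsUnit TV.det)
  (TW : Matrix (Fin M) (Fin M) F) (hW : TW.IsSymm) (hWd : IsUnit TW.det)
variable (mA : GL (Fin n) (mixedSpace E) →* arch F E c (n + n) (hermD F E e TV TW))
  (hP : ∀ r, IsSiegelDelta F E c e TV TW (UnitaryGroup.archToAdelic F E c (n + n) (hermD F E e TV TW) (mA r)))
  (hΔ : ∀ r, archMat E (Fin n) (deltaBlock F E c e TV TW (UnitaryGroup.archToAdelic F E c (n + n) (hermD F E e TV TW) (mA r))) =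
    ((r : GL (Fin n) (mixedSpace E)) : Matrix (Fin n) (Fin n) (mixedSpace E)))

/-! ## §1 The coordinates of `x(mA r) = det_Δ (mA r, 1)` -/

omit [Algebra.IsQuadraticExtension F E] in
include hΔ in
/-- real coordinates of `x(mA (signPatternGL ρ))`: `σ_w(x_w) = det ρ(w)`. [cite: Kudla1994, §3] -/
theorem det_archMat_deltaBlock_signPattern_fst (ρ : {w : InfinitePlace E // w.IsReal} → GL (Fin n) ℝ)
    (w : {w : InfinitePlace E // w.IsReal}) :
    (archMat E (Fin n) (deltaBlock F E c e TV TW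
        (UnitaryGroup.archToAdelic F E c (n + n) (hermD F E e TV TW) (mA (signPatternGL E ρ))))).det.1 w =
      ((ρ w : GL (Fin n) ℝ) : Matrix (Fin n) (Fin n) ℝ).det := by
  rw [hΔ, ← evalR_apply, RingHom.map_det, RingHom.mapMatrix_apply, coe_signPatternGL, map_evalR_signPatternMat]

omit [Algebra.IsQuadraticExtension F E] in
include hΔ in
/-- complex coordinates of `x(mA (signPatternGL ρ))`: `σ_w(x_w) = 1`. [cite: Kudla1994, §3] -/
theorem det_adeleMatAt_deltaBlock_signPattern (ρ : {w : InfinitePlace E // w.IsReal} → GL (Fin n) ℝ)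
    (w : {w : InfinitePlace E // w.IsComplex}) :
    (adeleMatAt E (Fin n) w (deltaBlock F E c e TV TW
        (UnitaryGroup.archToAdelic F E c (n + n) (hermD F E e TV TW) (mA (signPatternGL E ρ))))).det = 1 := by
  rw [← archMat_map_evalC, hΔ, coe_signPatternGL, map_evalC_signPatternMat, Matrix.det_one]

/-! ## §2 `modDelta = 1` -/

omit [Algebra.IsQuadraticExtension F E] in
include hP hΔ in
/-- **`modDelta (mA r, 1) = 1`** for a sign pattern `r = signPatternGL ρ` with `|det ρ(w)| = 1` at every real place.
[cite: Kudla1994, §3] [cite: HarrisKudlaSweet1996, §1 (1.15)] -/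
theorem modDelta_leviCayley_signPattern_eq_one (ρ : {w : InfinitePlace E // w.IsReal} → GL (Fin n) ℝ)
    (hρ : ∀ w, |((ρ w : GL (Fin n) ℝ) : Matrix (Fin n) (Fin n) ℝ).det| = 1) :
    modDelta F E c e TV TW (UnitaryGroup.archToAdelic F E c (n + n) (hermD F E e TV TW) (mA (signPatternGL E ρ))) = 1 := by
  have hu : IsUnit (detDelta F E c e TV TW (UnitaryGroup.archToAdelic F E c (n + n) (hermD F E e TV TW) (mA (signPatternGL E ρ)))) :=
    isUnit_detDelta_of_isSiegelDelta F E c e TV TW _ (hP _)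
  have hsq := modDelta_archToAdelic_sq_eq_prod F E c e TV TW (mA (signPatternGL E ρ)) hu
  rw [Finset.prod_eq_one (fun w _ => by rw [det_archMat_deltaBlock_signPattern_fst F E c e TV TW mA hΔ ρ w, hρ w]),
    Finset.prod_eq_one (fun w _ => by rw [det_adeleMatAt_deltaBlock_signPattern F E c e TV TW mA hΔ ρ w, map_one]),
    mul_one] at hsq
  have hnn : 0 ≤ modDelta F E c e TV TW (UnitaryGroup.archToAdelic F E c (n + n) (hermD F E e TV TW) (mA (signPatternGL E ρ))) := by
    unfold modDelta
    rw [dif_pos hu]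
    exact Real.sqrt_nonneg _
  nlinarith [hsq, hnn]

/-! ## §3 `χ(x(mA r)) = ∏_{w real} χ̃_w(det ρ(w))` and `= 1` at the pair representative -/

omit [Algebra.IsQuadraticExtension F E] in
include hP hΔ in
/-- **`χ(det_Δ (mA r, 1)) = ∏_{w real} χ̃_w(det ρ(w))`** for a sign pattern `r = signPatternGL ρ` (complex coordinates of
`x` are `1`). [cite: GelbartRogawski1991, §3.1 p. 456 (3.1.2)] [cite: Kudla1994, §3] -/
theorem chiDet_leviCayley_signPattern_eq_prod (χ : HeckeCharacter E) (ρ : {w : InfinitePlace E // w.IsReal} → GL (Fin n) ℝ) :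
    chiDet F E c e TV TW χ (UnitaryGroup.archToAdelic F E c (n + n) (hermD F E e TV TW) (mA (signPatternGL E ρ))) =
      ∏ w : {w : InfinitePlace E // w.IsReal}, archComponentR E χ w (Matrix.GeneralLinearGroup.det (ρ w)) := by
  set p := UnitaryGroup.archToAdelic F E c (n + n) (hermD F E e TV TW) (mA (signPatternGL E ρ)) with hp
  have hu : IsUnit (detDelta F E c e TV TW p) := isUnit_detDelta_of_isSiegelDelta F E c e TV TW _ (hP _)
  have hval : ((hu.unit : ideleGroup E) : AdeleRing (𝓞 E) E) = detDelta F E c e TV TW p := IsUnit.unit_spec hu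
  have h2 : ((hu.unit : ideleGroup E) : AdeleRing (𝓞 E) E).2 = 1 := by
    rw [hval]
    exact UnitaryDualPair.ArchSplitting.snd_det_deltaBlock_archToAdelic F E c (hermD F E e TV TW) (mA (signPatternGL E ρ))
  unfold chiDet
  rw [dif_pos hu, apply_eq_prod_archComponent_of_snd_eq_one E χ hu.unit h2,
    ← Fintype.prod_subtype_mul_prod_subtype (fun w : InfinitePlace E => w.IsReal)]
  -- complex factors are `1`
  have hC : ∏ w : {w : InfinitePlace E // ¬ w.IsReal}, χ.archComponent w.1 (ideleInfiniteComponent E w.1 hu.unit) = 1 := by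
    refine Finset.prod_eq_one fun w _ => ?_
    have hw : w.1.IsComplex := not_isReal_iff_isComplex.1 w.2
    have h1 : ideleInfiniteComponent E w.1 hu.unit = 1 := by
      apply Units.ext
      apply (Completion.extensionEmbedding w.1).injective
      rw [val_ideleInfiniteComponent, hval, Units.val_one, map_one]
      have h := det_adeleMatAt_deltaBlock_signPattern F E c e TV TW mA hΔ ρ ⟨w.1, hw⟩
      unfold adeleMatAt at h
      rw [← RingHom.mapMatrix_apply, ← RingHom.map_det, adeleAt_apply] at h
      exact h
    rw [h1, map_one]
  rw [hC, mul_one]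
  refine Finset.prod_congr rfl fun w _ => ?_
  -- real factors: `χ_w(u_w) = χ̃_w(σ_w u_w) = χ̃_w(det ρ w)`
  rw [← archComponentR_map E χ w]
  congr 1
  apply Units.ext
  rw [Units.coe_map, RingHom.toMonoidHom_eq_coe, MonoidHom.coe_coe, val_ideleInfiniteComponent, hval,
    Matrix.GeneralLinearGroup.val_det_apply, ← det_archMat_deltaBlock_signPattern_fst F E c e TV TW mA hΔ ρ w, det_archMat_fst]
  rfl

include hP hΔ hcδ hδ in
/-- **`χ(det_Δ) = 1` at the PAIR representative**: for `ρ = mulSingle w_k ε · mulSingle (c⁻¹w_k) ε` (any enumeration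
`eκ : κ ⊕ κ ≃ {w real}`, `inl k ↦ w_k`, `inr k ↦ c⁻¹ w_k`) and `χ|_{𝕀_F} = ε_{E/F}^m`:
`χ(det_Δ (mA (signPatternGL ρ), 1)) = χ̃_{w_k}(det ε) · χ̃_{c⁻¹ w_k}(det ε) = 1`. [cite: GelbartRogawski1991, §3.1 p. 456 (3.1.2)] -/
theorem chiDet_leviCayley_pair_eq_one (hc : c ≠ 1) {m : ℕ} {χ : HeckeCharacter E} (hχ : IsSplittingCharExt F E m χ)
    {κ : Type*} [Fintype κ] (wOf : κ → {w : InfinitePlace E // w.IsReal}) (eκ : κ ⊕ κ ≃ {w : InfinitePlace E // w.IsReal})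
    (he₁ : ∀ k, eκ (Sum.inl k) = wOf k) (he₂ : ∀ k, eκ (Sum.inr k) = ⟨c⁻¹ • (wOf k).1, isReal_smul_iff.mpr (wOf k).2⟩)
    (ε : GL (Fin n) ℝ) (k : κ) :
    chiDet F E c e TV TW χ (UnitaryGroup.archToAdelic F E c (n + n) (hermD F E e TV TW)
        (mA (signPatternGL E (Pi.mulSingle (wOf k) ε *
          Pi.mulSingle (⟨c⁻¹ • (wOf k).1, isReal_smul_iff.mpr (wOf k).2⟩ : {w : InfinitePlace E // w.IsReal}) ε)))) = 1 := by
  rw [chiDet_leviCayley_signPattern_eq_prod F E c e TV TW mA hP hΔ]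
  set ρ : {w : InfinitePlace E // w.IsReal} → GL (Fin n) ℝ := Pi.mulSingle (wOf k) ε *
    Pi.mulSingle (⟨c⁻¹ • (wOf k).1, isReal_smul_iff.mpr (wOf k).2⟩ : {w : InfinitePlace E // w.IsReal}) ε with hρ
  set f : {w : InfinitePlace E // w.IsReal} → ℂˣ := fun w => archComponentR E χ w (Matrix.GeneralLinearGroup.det (ρ w)) with hf
  -- injectivity bookkeeping from the enumeration
  have hinj : Function.Injective wOf := fun j k' h => Sum.inl_injective (eκ.injective (by rw [he₁, he₁, h]))
  have hne : ∀ j k' : κ, (⟨c⁻¹ • (wOf j).1, isReal_smul_iff.mpr (wOf j).2⟩ : {w : InfinitePlace E // w.IsReal}) ≠ wOf k' := by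
    intro j k' h
    have h1 : eκ (Sum.inr j) = eκ (Sum.inl k') := by rw [he₂, he₁, h]
    exact Sum.inr_ne_inl (eκ.injective h1)
  have hinj' : ∀ j k' : κ, (⟨c⁻¹ • (wOf j).1, isReal_smul_iff.mpr (wOf j).2⟩ : {w : InfinitePlace E // w.IsReal}) =
      ⟨c⁻¹ • (wOf k').1, isReal_smul_iff.mpr (wOf k').2⟩ → j = k' :=
    fun j k' h => Sum.inr_injective (eκ.injective (by rw [he₂, he₂, h]))
  -- the values of `ρ`
  have hρ1 : ∀ j, ρ (wOf j) = if j = k then ε else 1 := by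
    intro j
    rw [hρ, Pi.mul_apply, Pi.mulSingle_apply, Pi.mulSingle_apply, if_neg (Ne.symm (hne k j)), mul_one]
    by_cases h : j = k
    · rw [if_pos (congrArg wOf h), if_pos h]
    · rw [if_neg (fun h' => h (hinj h')), if_neg h]
  have hρ2 : ∀ j, ρ ⟨c⁻¹ • (wOf j).1, isReal_smul_iff.mpr (wOf j).2⟩ = if j = k then ε else 1 := by
    intro j
    rw [hρ, Pi.mul_apply, Pi.mulSingle_apply, Pi.mulSingle_apply, if_neg (hne j k), one_mul]
    by_cases h : j = k
    · rw [if_pos ((fun h => by rw [h]) h), if_pos h]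
    · rw [if_neg (fun h' => h (hinj' j k h')), if_neg h]
  -- sum over the enumeration, pair by pair
  rw [← Fintype.prod_equiv eκ (fun s => f (eκ s)) f (fun _ => rfl), Fintype.prod_sum_type, ← Finset.prod_mul_distrib]
  refine Finset.prod_eq_one fun j _ => ?_
  simp only [hf, he₁, he₂]
  rw [hρ1, hρ2]
  by_cases h : j = k
  · rw [if_pos h]
    exact archComponentR_mul_archComponentR_smul_inv F E c hχ hc hcδ hδ (wOf j) _
  · rw [if_neg h, map_one, map_one, map_one, mul_one]

end Literature.NumberTheory.GelbartRogawski1991.GRConstructionGen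

end
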